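import Literature.Probability.Percolation.KhSThreeDisorderContour
import Literature.Probability.Percolation.KhSThreeDisorderNormalisation
import Literature.Probability.Percolation.KhSThreeDisorderBoundaryValuesArcs
import HarnessLib

/-!
# The discrete boundary-value problem of the Khristoforov–Smirnov three-disorder observable (`k = 3`), in one statement

Topic `Literature/Probability/Percolation`; three-disorder lineage, PACKAGING file (no new combinatorics): the loop-side theorems of
§2 of Khristoforov–Smirnov for three boundary disorders — Definition 3 (`Hobs`, `Fobs`), Lemma 4 (`khsLemma4_holds`), Corollary 5
(`khsCorollary5`, `khsGlobalContour_eq_zero`), the normalisation `H₁ + H₂ + H₃ = 1` (`sum_hobs_eq_one`) and the boundary law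
eq. (4) on every arc (`hobs_opposite_eq_zero`, `hobs_add_hobs_succ_eq_one`) — are collected into ONE proposition
`KhSDiscreteBVP D` about a 3-marked discrete domain `D : TriMarkedDomain 3`, proved for EVERY `D` (`khsDiscreteBVP_holds`). This is the
exact lattice input of §3 of the paper (precompactness, Morera, the Riemann–Hilbert problem «`F` holomorphic, `F(∂_jΩ) ⊂ [τ^{j−1}, τ^{j+1}]`»),
stated so that a write-up can cite a single declaration:

* `edge_fn` — `F` is a function of the mid-edge (both faces of an `H_G`-edge read the same value);
* `nonneg`, `sum_one`, `le_one` — `H_j(z) ∈ [0, 1]`, `Σ_j H_j(z) = 1` at every side of a face with three `H_G`-sides;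
* `lemma4` (printed `oppFace` indexing) and `lemma4_ccw` (the five-point files' `ccwNbr` indexing) — `Σ_i τ^i F(z_i) = 0`;
* `corollary5`, `global_contour` — the discrete contour integrals of `F` with the printed displacement weights vanish, for every finite
  set of valence-3 faces and for all of them at once (the discrete `∮_{∂Ω} F dz = 0`);
* `boundary` — at a boundary mid-edge `z` of the arc `A_a` (bond `s(g, o)`, `g ∈ G`, `o ∉ G`, dart `(g, o) ∈ D.stretch a`):
  `H_{a+2}(z) = 0`, `H_a(z) + H_{a+1}(z) = 1` and `F(z) = τ^a H_a(z) + τ^{a+1} H_{a+1}(z)` — `F(z)` lies on the segment `[τ^a, τ^{a+1}]`.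

Also recorded: `allSides_iff_two_le` (a face has its three sides in `H_G` iff at least two of its sites lie in `G` — the printed
hypothesis «`z₁, z₂, z₃ ∈ MidEdges(Ω)`» of Lemma 4) and the `F`-form of the boundary law on every arc, `fobs_of_mem_stretch`.
The percolation side of eq. (4) (`KhSThreeDisorderCrossing.lean`: `H₁(z) = P_{1/2}[∂_{y₀z} ↔ A₁]`, …) is deliberately NOT imported
here; this file is the loop-side problem only.

## References
* M. Khristoforov, S. Smirnov, *Percolation and O(1) loop model*, arXiv:2111.15612 (2021), §2: Definition 3 and Lemma 4 (arXiv v1 p. 4),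
  Corollary 5 and eq. (4) with Remark 6 (p. 5); §3 (pp. 5–6) for the use of these facts.

## Mathlib / tree
Tree only: `KhSThreeDisorderObservable.lean` (`AllSides`, `Hobs`, `Fobs`, `FobsAt`, `khsLemma4_holds`, `khsLemma4_ccw`),
`KhSThreeDisorderContour.lean` (`bdryIntegral`, `allSidesFaces₃`, `khsCorollary5`, `khsGlobalContour_eq_zero`, `fobs_oppFace_oppIdx`),
`KhSThreeDisorderNormalisation.lean` (`sum_hobs_eq_one`, `hobs_nonneg`, `hobs_le_one`), `KhSThreeDisorderBoundaryValuesArcs.lean`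
(`hobs_opposite_eq_zero`, `hobs_add_hobs_succ_eq_one`), `MarkedLoopSpace.lean` (`mem_hBonds`, `exists_rep_of_mem_hBonds`).
-/

open Finset

namespace Literature.Probability.Percolation.MarkedLoops

open Literature.Probability.Percolation Literature.Probability.LatticeModels
open Literature.Probability.Percolation.FivePoint (side tau ccwNbr hexFaceVertices_eq_triple)
open TriMarkedDomain

section AllSidesIff

variable {nm : ℕ} (D : TriMarkedDomain nm)

/-- **the printed hypothesis of Lemma 4**: the three sides of the face `v` are edges of `H_G` iff at least two of the three sites of
`v` lie in `G` (an edge of `H` is an edge of `H_G` iff its dual bond has an endpoint in `G`).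
[cite: KhristoforovSmirnov2021, §2 Lemma 4 (arXiv v1 p. 4: «z₁, z₂, z₃ ∈ MidEdges(Ω)»)] -/
theorem allSides_iff_two_le (v : HexVertex) :
    AllSides D v ↔ 2 ≤ #((hexFaceVertices v).filter (· ∈ D.verts)) := by
  classical
  constructor
  · intro hv
    -- at most one vertex of `v` lies outside `G`: two outside would make the side between them a non-edge of `H_G`
    by_contra hlt
    push Not at hlt
    -- some index `i` with both `faceVertex v (i+1)`, `faceVertex v (i+2)` outside `G`
    have key : ∃ i : Fin 3, faceVertex v (i + 1) ∉ D.verts ∧ faceVertex v (i + 2) ∉ D.verts := by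
      by_contra hno
      push Not at hno
      -- then at least two vertices are in `G`
      have hin : ∀ i : Fin 3, faceVertex v (i + 1) ∉ D.verts → faceVertex v (i + 2) ∈ D.verts := hno
      -- case on vertex 0
      have hcard : 2 ≤ #((hexFaceVertices v).filter (· ∈ D.verts)) := by
        have hsub : ∀ a b : Fin 3, a ≠ b → faceVertex v a ∈ D.verts → faceVertex v b ∈ D.verts →
            2 ≤ #((hexFaceVertices v).filter (· ∈ D.verts)) := by
          intro a b hab ha hb
          have hins : ({faceVertex v a, faceVertex v b} : Finset (Site 2)) ⊆ (hexFaceVertices v).filter (· ∈ D.verts) := by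
            intro x hx
            rw [Finset.mem_insert, Finset.mem_singleton] at hx
            rw [Finset.mem_filter]
            rcases hx with rfl | rfl
            · exact ⟨faceVertex_mem v a, ha⟩
            · exact ⟨faceVertex_mem v b, hb⟩
          have hne : faceVertex v a ≠ faceVertex v b := fun h => hab (faceVertex_injective v h)
          calc 2 = #({faceVertex v a, faceVertex v b} : Finset (Site 2)) := (Finset.card_pair hne).symm
            _ ≤ _ := Finset.card_le_card hins
        by_cases h1 : faceVertex v (0 + 1) ∈ D.verts
        · by_cases h2 : faceVertex v (0 + 2) ∈ D.verts
          · exact hsub (0 + 1) (0 + 2) (by decide) h1 h2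
          · -- vertex 2 ∉ G ⇒ (with i = 1: faceVertex (1+1) = vertex 2 ∉ G ⇒ vertex (1+2) = vertex 0 ∈ G)
            have h0 : faceVertex v (1 + 2) ∈ D.verts := hin 1 (by simpa using h2)
            exact hsub (0 + 1) (1 + 2) (by decide) h1 h0
        · have h2 : faceVertex v (0 + 2) ∈ D.verts := hin 0 h1
          -- vertex 1 ∉ G ⇒ with i = 2: faceVertex (2+1) = vertex 0; need vertex 0 ∈ G: from i = 2, faceVertex (2+1) = v0?
          -- use i = 2: faceVertex v (2+1) = faceVertex v 0; if v0 ∉ G then faceVertex v (2+2) = v1 ∈ G, contradiction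
          have h0 : faceVertex v (2 + 1) ∈ D.verts := by
            by_contra h0
            exact h1 (by simpa using hin 2 h0)
          exact hsub (0 + 2) (2 + 1) (by decide) h2 h0
      exact absurd hcard (not_le.2 hlt)
    obtain ⟨i, h1, h2⟩ := key
    obtain ⟨a, b, he, ha, -⟩ := exists_rep_of_mem_hBonds D (hv i)
    -- `side v i = s(faceVertex v (i+1), faceVertex v (i+2)) = s(a, b)` with `a ∈ G`
    have he' : s(faceVertex v (i + 1), faceVertex v (i + 2)) = s(a, b) := he
    rcases Sym2.eq_iff.1 he' with ⟨h3, -⟩ | ⟨-, h4⟩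
    · exact h1 (h3 ▸ ha)
    · exact h2 (h4 ▸ ha)
  · intro h i
    -- at least two sites in `G` ⇒ one of the endpoints of the `i`-th side is in `G`
    by_cases h1 : faceVertex v (i + 1) ∈ D.verts
    · exact mem_hBonds D (by have := adj_faceVertex_succ v (i + 1); rwa [add_assoc] at this) (Or.inl h1)
    by_cases h2 : faceVertex v (i + 2) ∈ D.verts
    · exact mem_hBonds D (by have := adj_faceVertex_succ v (i + 1); rwa [add_assoc] at this) (Or.inr h2)
    exfalso
    have hsub : (hexFaceVertices v).filter (· ∈ D.verts) ⊆ {faceVertex v i} := by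
      intro x hx
      rw [Finset.mem_filter, hexFaceVertices_eq_triple v i] at hx
      rw [Finset.mem_singleton]
      rcases Finset.mem_insert.1 hx.1 with e | e
      · exact e
      rcases Finset.mem_insert.1 e with e | e
      · exact absurd (e ▸ hx.2) h1
      · rw [Finset.mem_singleton] at e; exact absurd (e ▸ hx.2) h2
    have := (Finset.card_le_card hsub).trans (Finset.card_singleton _).le
    omega

end AllSidesIff

section DiscreteBVP

variable (D : TriMarkedDomain 3)

/-- **eq. (4) in `F`-form on every arc**: at a boundary mid-edge `z` of the arc `A_a`, `F(z) = τ^a H_a(z) + τ^{a+1} H_{a+1}(z)`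
(with `H_a + H_{a+1} = 1`: `F(z)` lies on the segment `[τ^a, τ^{a+1}]`; for `a = 0` this is `fobs_of_stretch_zero`).
[cite: KhristoforovSmirnov2021, §2 eq. (4) and Remark 6 (arXiv v1 p. 5)] -/
theorem fobs_of_mem_stretch {v : HexVertex} (hv : AllSides D v) {i : Fin 3} {g o : Site 2}
    (he : side v i = s(g, o)) (hg : g ∈ D.verts) (ho : o ∉ D.verts) {a : Fin 3} (hd : (g, o) ∈ D.stretch a) :
    Fobs D v i = tau ^ (a : ℕ) * (Hobs D v i a : ℂ) + tau ^ ((a + 1 : Fin 3) : ℕ) * (Hobs D v i (a + 1) : ℂ) := by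
  have h0 := hobs_opposite_eq_zero D hv he hg ho hd
  unfold Fobs
  rw [Fin.sum_univ_three]
  have h3 : ∀ a' : Fin 3, a' = 0 ∨ a' = 1 ∨ a' = 2 := by decide
  rcases h3 a with rfl | rfl | rfl
  · have e : (0 : Fin 3) + 2 = 2 := rfl
    rw [e] at h0
    rw [h0]
    push_cast
    simp only [Fin.val_zero, Fin.val_one, pow_zero, pow_one, one_mul, mul_zero, add_zero]
  · have e : (1 : Fin 3) + 2 = 0 := rfl
    rw [e] at h0
    rw [h0]
    push_cast
    simp only [Fin.val_zero, Fin.val_one, Fin.val_two, pow_zero, pow_one, mul_zero, zero_add]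
  · have e : (2 : Fin 3) + 2 = 1 := rfl
    rw [e] at h0
    rw [h0]
    push_cast
    simp only [Fin.val_zero, Fin.val_one, Fin.val_two, pow_zero, pow_one, one_mul, mul_zero, add_zero]
    ring

/-- **The discrete boundary-value problem of the three-disorder observable** (Khristoforov–Smirnov §2 for `k = 3`, loop side),
as ONE proposition about a 3-marked discrete domain: `F = Σ_j τ^j H_j` is a function of the mid-edge with barycentric weights
`H_j ∈ [0,1]`, `Σ_j H_j = 1`; it satisfies Lemma 4 at every face with three `H_G`-sides (both indexings), hence Corollary 5 (all
discrete contour integrals vanish); and on the arc `A_a` its values lie on the segment `[τ^a, τ^{a+1}]` (`H_{a+2} = 0`).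
[cite: KhristoforovSmirnov2021, §2 Definition 3, Lemma 4 (arXiv v1 p. 4), Corollary 5, eq. (4), Remark 6 (p. 5)] -/
structure KhSDiscreteBVP (D : TriMarkedDomain 3) : Prop where
  /-- `F` is a function of the mid-edge: the two faces of an `H_G`-edge read the same value. -/
  edge_fn : ∀ (v : HexVertex) (i : Fin 3), Fobs D (oppFace v i) (oppIdx v i) = Fobs D v i
  /-- `H_j(z) ≥ 0`. -/
  nonneg : ∀ (v : HexVertex) (i j : Fin 3), 0 ≤ Hobs D v i j
  /-- `Σ_j H_j(z) = 1` at every side of a face with three `H_G`-sides. -/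
  sum_one : ∀ v : HexVertex, AllSides D v → ∀ i : Fin 3, ∑ j : Fin 3, Hobs D v i j = 1
  /-- `H_j(z) ≤ 1` there. -/
  le_one : ∀ v : HexVertex, AllSides D v → ∀ i j : Fin 3, Hobs D v i j ≤ 1
  /-- Lemma 4, printed indexing: `Σ_i τ^i F(z_i) = 0` over the three sides `oppFace v i` of `v`. -/
  lemma4 : ∀ v : HexVertex, AllSides D v → ∑ i : Fin 3, tau ^ (i : ℕ) * Fobs D v i = 0
  /-- Lemma 4 in the anticlockwise `ccwNbr` indexing of the five-point files. -/
  lemma4_ccw : ∀ v : HexVertex, AllSides D v → ∑ k : Fin 3, tau ^ (k : ℕ) * FobsAt D v (ccwNbr v k) = 0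
  /-- Corollary 5: the discrete contour integral along the boundary of any finite set of valence-3 faces vanishes. -/
  corollary5 : ∀ Λ : Finset HexVertex, (∀ v ∈ Λ, AllSides D v) → bdryIntegral (Fobs D) Λ = 0
  /-- the global contour: `∮_{∂Ω} F dz = 0` over all faces with three `H_G`-sides. -/
  global_contour : bdryIntegral (Fobs D) (allSidesFaces₃ D) = 0
  /-- eq. (4), loop side, every arc: at a boundary mid-edge of `A_a`, `H_{a+2} = 0`, `H_a + H_{a+1} = 1`,
  `F = τ^a H_a + τ^{a+1} H_{a+1}`. -/
  boundary : ∀ v : HexVertex, AllSides D v → ∀ (i : Fin 3) (g o : Site 2) (a : Fin 3),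
      side v i = s(g, o) → g ∈ D.verts → o ∉ D.verts → (g, o) ∈ D.stretch a →
      Hobs D v i (a + 2) = 0 ∧ Hobs D v i a + Hobs D v i (a + 1) = 1 ∧
        Fobs D v i = tau ^ (a : ℕ) * (Hobs D v i a : ℂ) + tau ^ ((a + 1 : Fin 3) : ℕ) * (Hobs D v i (a + 1) : ℂ)

/-- ★ **Every 3-marked discrete domain satisfies the discrete boundary-value problem** `KhSDiscreteBVP` — the loop-side content of
Khristoforov–Smirnov §2 at `k = 3`, collected from the tree theorems `fobs_oppFace_oppIdx`, `hobs_nonneg`, `sum_hobs_eq_one`,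
`hobs_le_one`, `khsLemma4_holds`, `khsLemma4_ccw`, `khsCorollary5`, `khsGlobalContour_eq_zero`, `hobs_opposite_eq_zero`,
`hobs_add_hobs_succ_eq_one`, `fobs_of_mem_stretch`.
[cite: KhristoforovSmirnov2021, §2 Definition 3, Lemma 4 (arXiv v1 p. 4), Corollary 5, eq. (4), Remark 6 (p. 5)] -/
theorem khsDiscreteBVP_holds : KhSDiscreteBVP D where
  edge_fn := fobs_oppFace_oppIdx D
  nonneg := hobs_nonneg D
  sum_one := fun _ hv i => sum_hobs_eq_one D hv i
  le_one := fun _ hv i j => hobs_le_one D hv i j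
  lemma4 := khsLemma4_holds D
  lemma4_ccw := khsLemma4_ccw D
  corollary5 := khsCorollary5 D
  global_contour := khsGlobalContour_eq_zero D
  boundary := fun _ hv _ _ _ _ he hg ho hd =>
    ⟨hobs_opposite_eq_zero D hv he hg ho hd, hobs_add_hobs_succ_eq_one D hv he hg ho hd, fobs_of_mem_stretch D hv he hg ho hd⟩

/-- the problem at every valence-3 vertex in the printed form of the hypothesis: two of the three sites of `v` in `G` suffice.
[cite: KhristoforovSmirnov2021, §2 Lemma 4 (arXiv v1 p. 4)] -/
theorem khsLemma4_of_two_le {v : HexVertex} (h : 2 ≤ #((hexFaceVertices v).filter (· ∈ D.verts))) :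
    ∑ i : Fin 3, tau ^ (i : ℕ) * Fobs D v i = 0 :=
  (khsDiscreteBVP_holds D).lemma4 v ((allSides_iff_two_le D v).2 h)

end DiscreteBVP

end Literature.Probability.Percolation.MarkedLoops
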